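/-
Copyright (c) 2026 the pub-hodgecm-mathlib formalisation cell (harness21).  Prover seat hodgecm-mathlib-LH4-p04 (g3), req620 Track A «(D-RAM) FOUR-FRAME» squad
(unit U2H_HSide, the (ρ2b′-X) payer road of LH4-p14 (g3) (RHO2BX-ORDER v1, organ O-Sum ∕ T5s «TORIC CENSUS SUM», TYPE U); dealer∕pen LH4-plan (g12) WORD #21∕#22, LH4-p14 (g3)
04:08Z hand-over; letters of record = LH4-p08 (g4) T5a sheet v3 via LH4-p10 (g3)'s socket read 04:13Z (a)(b)(c); inputs E1 v1 (F0P3a-p01 (g32)) ∕ p14's frozen census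
`osum_typeU_identity.v2` fa1812e2; REF5 (g23) R5-152 Lean-semantics read (7 760 tuples).  2026-09-04.
-/
import Summits.HodgeConjecture.HodgeConjecture.Theorems.F0P3cDyRamKappaCountBoxSumBlocks   -- ★ (LH4-p14 (g3)): the κ-BOX-SUM block tools; brings `Finset` algebra over `ℚ`
import Mathlib.Algebra.Ring.GeomSum
import HarnessLib

/-!
# Crux `H413`, line LH4 «(D-RAM) FOUR-FRAME» road — unit U2H (ii-H), the (ρ2b′-X) payer: O-Sum ∕ T5s «TORIC CENSUS SUM», TYPE U — FILE 1∕3 «BLOCKS»: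
# parity-ray ∕ window re-indexing, the geometric and alternating index sums, and the CELL EVALUATIONS (the `+` column, the `−` row) of the type-U toric level census

Cell `hodgecm-mathlib` (D-0151), FLOOR 0, crux item H413 = `stmt-HodgeConjecture-24833`, route of record `HCCMUnconditional`; squad F0∕P3c∕LH4 (req618∕req620); registered stub
served: `F0P3cDyRamFourFrameU2H.stub_U2H_fixedPointCensus_typeTwo_unit0` ((ρ2b′-X), tree `Cruxes/H413/Lines/F0_P3c_DyRamFourFrame_U2H_HSide.lean` ED. 15 :418) through the
★ spine p857061 ∘ p857119 ∘ p857277 `latticeCensus_literals_of_signedCensus (hOrg)` (LH4-p14 (g3)), organ O-Sum.  THEOREMS ONLY (no `def`, no instance, no notation, no `sorry`,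
default heartbeats); lane `--supports stmt-HodgeConjecture-24833 --as helper` (count-neutral).  Pure finite-sum bookkeeping over `ℚ` — no lattices, no fields.

CONTENT.  §1 tools: `sum_range_parity_reindex` (the `j ≡ r (2)`, `r ≤ j ≤ N` as `r + 2u`), `sum_range_window_reindex`, `sum_range_ray_single` (one cell on a parity ray),
`geom_sum_mul'` ∕ `geom_sum_two_mul`, `alt_index_sum` (`Σ_{j<d} ±G j = −x^{d−1}`, `G j = (x+1)x^{j−1}`, `G 0 = 1`).  §2 the `+` COLUMN `colP_eval`: for `a ≥ 1` the cells of the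
type-U `+` table (`n₊(j,a) = (x²−1)x^{j−2−(j−a−d)∕2}` on `a + d ≤ j`, `j ≡ a + d (2)`) live on the ray `j = a + d + 2u` and, under the depth rules at the tokens (column `a = 0` all;
off the diagonal `j − a = jl − m` the LOW cells `2a ≤ m ∧ (j+a ≤ m ∨ j+a ≤ jl)`; on it LOW all and the TOP cells `n∕((x−1)x^{⌈(2a−m)∕2⌉−1})` under the top bit `d + m ≤ jl ∧ j < jl`),
sum to the geometric block `[2a ≤ m][2a + d ≤ jl]·(x²−1)x^{2a+d−2}·Σ_{u ≤ L−a} x^u` (`L = ⌊(jl−d)∕2⌋`) plus the TOP diagonal cell `[⌊m∕2⌋ < a < m][m + d ≤ jl]·(x+1)x^{a+d+u⋆+⌊m∕2⌋−1}`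
(`u⋆ = (jl−m−d)∕2`).  §3 the `−` ROW `rowM_eval`: one cell per row (`a = 0` below the conductor for `j ≢ d`, `a = j+1−d` from `d` on: `(x+1)x^{2j−d}` while `j ≤ d−1+⌊m∕2⌋`, and
the `−` TOP diagonal `(x+1)x^{j+⌈m∕2⌉−1}` under the top bit `jl + 1 = d + m ∧ j < jl`).
HONEST LABEL.  Count-neutral (`--supports`); nothing printed is asserted; (ρ2b′-X) `stub_U2H_fixedPointCensus_typeTwo_unit0` (U2H :418) stays a PROVER TARGET (an empirical
census law, kit-confirmed) until its payer lands; `HC_CM` is proved only modulo the 7 printed citations (2 remaining named inputs: hLiu418 = `stmt-HodgeConjecture-24832`, h413 =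
`stmt-HodgeConjecture-24833`) until rung 0 closes.

## References
* [Kottwitz1986BaseChangeUnits] R. E. Kottwitz, *Base change for unit elements of Hecke algebras*, Compositio Math. 60 (1986), §1 pp. 240–241 (orbital integrals of units as
  lattice counts modulo the torus).
* [Rogawski1990] J. D. Rogawski, *Automorphic Representations of Unitary Groups in Three Variables*, Ann. of Math. Stud. 123 (1990), §4.9 Prop. 4.9.1 (b) p. 55, Lemma 4.9.3 p. 56
  (the fixed-point census of a type-(2) element; the toric decomposition).
-/

set_option autoImplicit false

namespace Summit.HodgeConjecture.HodgeConjecture.Cruxes.H413.F0P3cDyRamToricCensusSumUnrBlocks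

open Finset


/-- PARITY RE-INDEXING of a column: the `j ≤ N` with `r ≤ j`, `j ≡ r (mod 2)` are `j = r + 2u`, `u < (N + 2 − r)∕2`. [folklore] -/
theorem sum_range_parity_reindex (F : ℕ → ℚ) (r N : ℕ) :
    ∑ j ∈ range (N + 1), (if r ≤ j ∧ (j - r) % 2 = 0 then F j else 0) = ∑ u ∈ range ((N + 2 - r) / 2), F (r + 2 * u) := by
  rw [← Finset.sum_filter]
  have hinj : Set.InjOn (fun u : ℕ => r + 2 * u) ↑(range ((N + 2 - r) / 2)) := by
    intro u _ v _ huv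
    have : r + 2 * u = r + 2 * v := huv
    omega
  have hset : (range (N + 1)).filter (fun j => r ≤ j ∧ (j - r) % 2 = 0) = (range ((N + 2 - r) / 2)).image (fun u => r + 2 * u) := by
    ext j
    simp only [Finset.mem_filter, Finset.mem_range, Finset.mem_image]
    constructor
    · rintro ⟨hjN, hrj, hpar⟩
      exact ⟨(j - r) / 2, by omega, by omega⟩
    · rintro ⟨u, hu, rfl⟩
      exact ⟨by omega, by omega, by omega⟩
  rw [hset, Finset.sum_image hinj]

/-- `(x² − 1)·Σ_{i<n} x^{2i} = x^{2n} − 1`. [folklore] -/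
theorem geom_sum_two_mul (x : ℚ) (n : ℕ) : ((x : ℚ) ^ 2 - 1) * ∑ i ∈ range n, x ^ (2 * i) = x ^ (2 * n) - 1 := by
  have h := geom_sum_mul (x ^ 2) n
  simp_rw [← pow_mul] at h
  rw [mul_comm]
  exact h

/-- `(x − 1)·Σ_{i<n} x^i = x^n − 1` (Mathlib's `geom_sum_mul`, commuted). [folklore] -/
theorem geom_sum_mul' (x : ℚ) (n : ℕ) : (x - 1) * ∑ i ∈ range n, x ^ i = x ^ n - 1 := by
  rw [mul_comm]; exact geom_sum_mul x n

/-- THE ALTERNATING INDEX SUM below the conductor: with `G 0 = 1`, `G j = (x+1)x^{j−1}` (`j ≥ 1`),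
`Σ_{j<d} (±G j)` (sign `+` iff `j ≡ d (mod 2)`) `= −x^{d−1}` for `d ≥ 1`. [folklore] -/
theorem alt_index_sum (x : ℚ) {d : ℕ} (hd : 1 ≤ d) :
    ∑ j ∈ range d, ((if j % 2 = d % 2 then (1 : ℚ) else -1) * (if j = 0 then (1 : ℚ) else (x + 1) * x ^ (j - 1))) = -x ^ (d - 1) := by
  induction d with
  | zero => omega
  | succ d ih =>
    rcases Nat.eq_zero_or_pos d with rfl | hd1
    · simp
    · rw [Finset.sum_range_succ]
      have ih' := ih hd1
      -- flip the signs of the first `d` terms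
      have hflip : ∑ j ∈ range d, ((if j % 2 = (d + 1) % 2 then (1 : ℚ) else -1) * (if j = 0 then (1 : ℚ) else (x + 1) * x ^ (j - 1))) =
          -∑ j ∈ range d, ((if j % 2 = d % 2 then (1 : ℚ) else -1) * (if j = 0 then (1 : ℚ) else (x + 1) * x ^ (j - 1))) := by
        rw [← Finset.sum_neg_distrib]
        refine Finset.sum_congr rfl fun j _ => ?_
        by_cases h : j % 2 = d % 2
        · have h' : ¬ j % 2 = (d + 1) % 2 := by omega
          rw [if_pos h, if_neg h']; ring
        · have h' : j % 2 = (d + 1) % 2 := by omega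
          rw [if_neg h, if_pos h']; ring
      rw [hflip, ih']
      have hdd : ¬ (d % 2 = (d + 1) % 2) := by omega
      have hd0 : d ≠ 0 := by omega
      simp only [hdd, if_false, hd0, Nat.add_sub_cancel]
      have e : x ^ d = x ^ (d - 1) * x := by rw [← pow_succ]; congr 1; omega
      rw [e]; ring

/-- WINDOW RE-INDEXING: the `j < N` with `A ≤ j < A + n` (`A + n ≤ N`) are `j = A + i`, `i < n`. [folklore] -/
theorem sum_range_window_reindex (F : ℕ → ℚ) {A n N : ℕ} (h : A + n ≤ N) :
    ∑ j ∈ range N, (if A ≤ j ∧ j < A + n then F j else 0) = ∑ i ∈ range n, F (A + i) := by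
  rw [← Finset.sum_filter]
  have hinj : Set.InjOn (fun i : ℕ => A + i) ↑(range n) := by
    intro u _ v _ huv
    have : A + u = A + v := huv
    omega
  have hset : (range N).filter (fun j => A ≤ j ∧ j < A + n) = (range n).image (fun i => A + i) := by
    ext j
    simp only [Finset.mem_filter, Finset.mem_range, Finset.mem_image]
    constructor
    · rintro ⟨hjN, hAj, hjA⟩
      exact ⟨j - A, by omega, by omega⟩
    · rintro ⟨i, hi, rfl⟩
      exact ⟨by omega, by omega, by omega⟩
  rw [hset, Finset.sum_image hinj]

/-- A SINGLE CELL on a parity ray: `Σ_{u<K} [D + 2u = T ∧ P u]·g u = [T − D even, D ≤ T, (T−D)∕2 < K, P ((T−D)∕2)]·g ((T−D)∕2)`. [folklore] -/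
theorem sum_range_ray_single (g : ℕ → ℚ) (P : ℕ → Prop) [DecidablePred P] (D T K : ℕ) :
    ∑ u ∈ range K, (if D + 2 * u = T ∧ P u then g u else 0) =
      if D ≤ T ∧ (T - D) % 2 = 0 ∧ (T - D) / 2 < K ∧ P ((T - D) / 2) then g ((T - D) / 2) else 0 := by
  have hiff : ∀ u, (D + 2 * u = T ∧ P u) ↔ (u = (T - D) / 2 ∧ (D ≤ T ∧ (T - D) % 2 = 0 ∧ P ((T - D) / 2))) := by
    intro u
    constructor
    · rintro ⟨h1, h2⟩
      have hu : u = (T - D) / 2 := by omega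
      exact ⟨hu, by omega, by omega, hu ▸ h2⟩
    · rintro ⟨hu, h1, h2, h3⟩
      exact ⟨by omega, hu ▸ h3⟩
  simp_rw [hiff]
  have hsplit : ∀ u, (if u = (T - D) / 2 ∧ (D ≤ T ∧ (T - D) % 2 = 0 ∧ P ((T - D) / 2)) then g u else 0) =
      (if u = (T - D) / 2 then (if D ≤ T ∧ (T - D) % 2 = 0 ∧ P ((T - D) / 2) then g u else 0) else 0) := by
    intro u
    by_cases h1 : u = (T - D) / 2
    · by_cases h2 : D ≤ T ∧ (T - D) % 2 = 0 ∧ P ((T - D) / 2)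
      · rw [if_pos ⟨h1, h2⟩, if_pos h1, if_pos h2]
      · rw [if_neg (fun h => h2 h.2), if_pos h1, if_neg h2]
    · rw [if_neg (fun h => h1 h.1), if_neg h1]
  simp_rw [hsplit]
  rw [Finset.sum_ite_eq' (range K)]
  simp only [Finset.mem_range]
  by_cases hK : (T - D) / 2 < K
  · by_cases h2 : D ≤ T ∧ (T - D) % 2 = 0 ∧ P ((T - D) / 2)
    · rw [if_pos hK, if_pos h2, if_pos ⟨h2.1, h2.2.1, hK, h2.2.2⟩]
    · rw [if_pos hK, if_neg h2, if_neg (fun h => h2 ⟨h.1, h.2.1, h.2.2.2⟩)]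
  · rw [if_neg hK, if_neg (fun h => hK h.2.2.1)]

/-- **THE `+` COLUMN `a ≥ 1`** of the type-U census: the cells live on the parity ray `j = a + d + 2u`; off the diagonal and on its low half they are alive iff `2a ≤ m`
and `2a + d + 2u ≤ jl` (a geometric block), the TOP diagonal cell (`m < 2a < 2m`, top bit `d + m ≤ jl ∧ j < jl`) is worth `(x+1)·x^{a + d + u⋆ + ⌊m∕2⌋ − 1}`, `u⋆ = (jl − m − d)∕2`. [folklore] -/
theorem colP_eval (x : ℚ) (hx0 : x ≠ 0) (hx1 : x ≠ 1) {d jl m : ℕ} (hd : 2 ≤ d) (hm : m ≤ jl)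
    (nP vP : ℕ → ℕ → ℚ)
    (hnP : ∀ j a, 1 ≤ a → nP j a = if a + d ≤ j ∧ (j - a - d) % 2 = 0 then (x ^ 2 - 1) * x ^ (j - 2 - (j - a - d) / 2) else 0)
    (hvOffP : ∀ j a, 1 ≤ a → j + m ≠ jl + a → vP j a = if 2 * a ≤ m ∧ (j + a ≤ m ∨ j + a ≤ jl) then nP j a else 0)
    (hvLowP : ∀ j a, 1 ≤ a → j + m = jl + a → 2 * a ≤ m → vP j a = nP j a)
    (hvTopP : ∀ j a, 1 ≤ a → j + m = jl + a → m < 2 * a →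
      vP j a = if d + m ≤ jl ∧ j < jl then nP j a / ((x - 1) * x ^ ((2 * a - m + 1) / 2 - 1)) else 0)
    (a : ℕ) (ha : 1 ≤ a) :
    ∑ j ∈ range (jl + 1), x ^ a * vP j a =
      (if 2 * a ≤ m ∧ 2 * a + d ≤ jl then (x ^ 2 - 1) * x ^ (2 * a + d - 2) * ∑ u ∈ range ((jl - d) / 2 - a + 1), x ^ u else 0) +
      (if m < 2 * a ∧ a < m ∧ m + d ≤ jl ∧ (jl - m - d) % 2 = 0 then (x + 1) * x ^ (a + d + (jl - m - d) / 2 + m / 2 - 1) else 0) := by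
  -- (1) the column lives on the parity ray `j = a + d + 2u`
  have hzero : ∀ j, ¬ (a + d ≤ j ∧ (j - a - d) % 2 = 0) → vP j a = 0 := by
    intro j hj
    have hn : nP j a = 0 := by rw [hnP j a ha, if_neg hj]
    by_cases hdiag : j + m = jl + a
    · by_cases hlow : 2 * a ≤ m
      · rw [hvLowP j a ha hdiag hlow, hn]
      · rw [hvTopP j a ha hdiag (by omega), hn, zero_div]; split_ifs <;> rfl
    · rw [hvOffP j a ha hdiag, hn]; split_ifs <;> rfl
  have hcol : ∀ j ∈ range (jl + 1), x ^ a * vP j a = if a + d ≤ j ∧ (j - (a + d)) % 2 = 0 then x ^ a * vP j a else 0 := by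
    intro j _
    by_cases h : a + d ≤ j ∧ (j - (a + d)) % 2 = 0
    · rw [if_pos h]
    · rw [if_neg h, hzero j (fun h' => h ⟨h'.1, by rw [← Nat.sub_sub]; exact h'.2⟩), mul_zero]
  rw [Finset.sum_congr rfl hcol, sum_range_parity_reindex (fun j => x ^ a * vP j a) (a + d) jl]
  -- (2) the cell values on the ray
  have hnray : ∀ u, nP (a + d + 2 * u) a = (x ^ 2 - 1) * x ^ (a + d + u - 2) := by
    intro u
    rw [hnP _ a ha, if_pos ⟨by omega, by omega⟩]
    congr 2; omega
  have hlowval : ∀ u, x ^ a * ((x ^ 2 - 1) * x ^ (a + d + u - 2)) = (x ^ 2 - 1) * x ^ (2 * a + d - 2) * x ^ u := by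
    intro u
    have e : a + (a + d + u - 2) = (2 * a + d - 2) + u := by omega
    calc x ^ a * ((x ^ 2 - 1) * x ^ (a + d + u - 2)) = (x ^ 2 - 1) * x ^ (a + (a + d + u - 2)) := by rw [pow_add]; ring
      _ = (x ^ 2 - 1) * x ^ (2 * a + d - 2) * x ^ u := by rw [e, pow_add]; ring
  have htopval : ∀ u, m < 2 * a → x ^ a * ((x ^ 2 - 1) * x ^ (a + d + u - 2) / ((x - 1) * x ^ ((2 * a - m + 1) / 2 - 1))) =
      (x + 1) * x ^ (a + d + u + m / 2 - 1) := by
    intro u hma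
    have hden : (x - 1) * x ^ ((2 * a - m + 1) / 2 - 1) ≠ 0 := mul_ne_zero (sub_ne_zero.2 hx1) (pow_ne_zero _ hx0)
    rw [← mul_div_assoc, div_eq_iff hden]
    have e : a + (a + d + u - 2) = (a + d + u + m / 2 - 1) + ((2 * a - m + 1) / 2 - 1) := by omega
    calc x ^ a * ((x ^ 2 - 1) * x ^ (a + d + u - 2)) = (x ^ 2 - 1) * x ^ (a + (a + d + u - 2)) := by rw [pow_add]; ring
      _ = (x ^ 2 - 1) * (x ^ (a + d + u + m / 2 - 1) * x ^ ((2 * a - m + 1) / 2 - 1)) := by rw [e, pow_add]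
      _ = (x + 1) * x ^ (a + d + u + m / 2 - 1) * ((x - 1) * x ^ ((2 * a - m + 1) / 2 - 1)) := by ring
  have hray : ∀ u, x ^ a * vP (a + d + 2 * u) a =
      (if 2 * a ≤ m then (if 2 * a + d + 2 * u ≤ jl then (x ^ 2 - 1) * x ^ (2 * a + d - 2) * x ^ u else 0) else 0) +
      (if d + 2 * u = jl - m ∧ (m < 2 * a ∧ a < m) then (x + 1) * x ^ (a + d + u + m / 2 - 1) else 0) := by
    intro u
    by_cases hlow : 2 * a ≤ m
    · rw [if_pos hlow, if_neg (show ¬ (d + 2 * u = jl - m ∧ (m < 2 * a ∧ a < m)) from fun h => absurd h.2.1 (by omega)), add_zero]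
      by_cases hdiag : a + d + 2 * u + m = jl + a
      · rw [hvLowP _ a ha hdiag hlow, hnray, hlowval, if_pos (by omega)]
      · rw [hvOffP _ a ha hdiag, hnray]
        by_cases hal : 2 * a + d + 2 * u ≤ jl
        · rw [if_pos ⟨hlow, by omega⟩, if_pos hal, hlowval]
        · rw [if_neg (by omega), if_neg hal, mul_zero]
    · rw [if_neg hlow, zero_add]
      by_cases hdiag : a + d + 2 * u + m = jl + a
      · rw [hvTopP _ a ha hdiag (by omega), hnray]
        by_cases hc : a < m
        · rw [if_pos (show d + m ≤ jl ∧ a + d + 2 * u < jl from ⟨by omega, by omega⟩), htopval u (by omega), if_pos ⟨by omega, by omega, hc⟩]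
        · rw [if_neg (show ¬ (d + m ≤ jl ∧ a + d + 2 * u < jl) from fun h => hc (by omega)), mul_zero, if_neg (fun h => hc h.2.2)]
      · rw [hvOffP _ a ha hdiag, if_neg (fun h => hlow h.1), mul_zero, if_neg (fun h => hdiag (by omega))]
  simp_rw [hray]
  rw [Finset.sum_add_distrib]
  congr 1
  · -- (3a) the low block
    by_cases hlow : 2 * a ≤ m
    · simp_rw [if_pos hlow]
      by_cases htop : 2 * a + d ≤ jl
      · rw [if_pos ⟨hlow, htop⟩, ← Finset.sum_filter]
        have hset : (range ((jl + 2 - (a + d)) / 2)).filter (fun u => 2 * a + d + 2 * u ≤ jl) = range ((jl - d) / 2 - a + 1) := by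
          ext u
          simp only [Finset.mem_filter, Finset.mem_range]
          omega
        rw [hset, Finset.mul_sum]
      · rw [if_neg (fun h => htop h.2)]
        refine Finset.sum_eq_zero fun u _ => ?_
        rw [if_neg (by omega)]
    · simp_rw [if_neg hlow]
      rw [Finset.sum_const_zero, if_neg (fun h => hlow h.1)]
  · -- (3b) the top cell
    rw [sum_range_ray_single (fun u => (x + 1) * x ^ (a + d + u + m / 2 - 1)) (fun _ => m < 2 * a ∧ a < m) d (jl - m)
      ((jl + 2 - (a + d)) / 2)]
    by_cases hc : m < 2 * a ∧ a < m ∧ m + d ≤ jl ∧ (jl - m - d) % 2 = 0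
    · obtain ⟨h1, h2, h4, h5⟩ := hc
      rw [if_pos (show m < 2 * a ∧ a < m ∧ m + d ≤ jl ∧ (jl - m - d) % 2 = 0 from ⟨h1, h2, h4, h5⟩),
        if_pos (show d ≤ jl - m ∧ (jl - m - d) % 2 = 0 ∧ (jl - m - d) / 2 < (jl + 2 - (a + d)) / 2 ∧ (m < 2 * a ∧ a < m) from
          ⟨by omega, by omega, by omega, h1, h2⟩)]
    · rw [if_neg hc, if_neg (show ¬ (d ≤ jl - m ∧ (jl - m - d) % 2 = 0 ∧ (jl - m - d) / 2 < (jl + 2 - (a + d)) / 2 ∧ (m < 2 * a ∧ a < m)) from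
        fun h => hc ⟨h.2.2.2.1, h.2.2.2.2, by omega, h.2.1⟩)]

/-- **THE `−` ROW `j`** of the type-U census: one cell per row — below the conductor the `a = 0` cell of the rows with `j ≢ d (mod 2)`, from `j = d` on the cell
`a = j + 1 − d`: alive (worth `(x+1)·x^{2j−d}`) while `j ≤ d − 1 + ⌊m∕2⌋`, and on the `−` diagonal (top bit `jl + 1 = d + m ∧ j < jl`) the TOP cells `(x+1)·x^{j + ⌈m∕2⌉ − 1}`, `j < jl`. [folklore] -/
theorem rowM_eval (x : ℚ) (hx0 : x ≠ 0) {d jl m : ℕ} (hd : 2 ≤ d) (hm : m ≤ jl - d + 1) (hdjl : d ≤ jl)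
    (nM vM : ℕ → ℕ → ℚ)
    (hnM : ∀ j a, nM j a = if (d ≤ j + 1 ∧ a + d = j + 1) ∨ (j + 1 < d ∧ a = 0 ∧ (j + d) % 2 = 1) then
      (if j = 0 then (1 : ℚ) else (x + 1) * x ^ (j - 1)) else 0)
    (hv0M : ∀ j, vM j 0 = nM j 0)
    (hvOffM : ∀ j a, 1 ≤ a → j + m ≠ jl + a → vM j a = if 2 * a ≤ m ∧ (j + a ≤ m ∨ j + a ≤ jl) then nM j a else 0)
    (hvLowM : ∀ j a, 1 ≤ a → j + m = jl + a → 2 * a ≤ m → vM j a = nM j a)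
    (hvTopM : ∀ j a, 1 ≤ a → j + m = jl + a → m < 2 * a → vM j a = if jl + 1 = d + m ∧ j < jl then nM j a / x ^ ((2 * a - m) / 2) else 0)
    (j : ℕ) (hj : j ≤ jl) :
    ∑ a ∈ range (jl + 2), x ^ a * vM j a =
      (if j < d ∧ j % 2 ≠ d % 2 then (if j = 0 then (1 : ℚ) else (x + 1) * x ^ (j - 1)) else 0) +
      (if d ≤ j ∧ j ≤ d - 1 + m / 2 then (x + 1) * x ^ (2 * j - d) else 0) +
      (if d + m / 2 ≤ j ∧ j < jl ∧ jl + 1 = d + m then (x + 1) * x ^ (j + m - m / 2 - 1) else 0) := by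
  -- a cell whose level count vanishes contributes nothing, whatever the depth rule
  have hzero : ∀ a, 1 ≤ a → nM j a = 0 → vM j a = 0 := by
    intro a ha hn
    by_cases hdiag : j + m = jl + a
    · by_cases hlow : 2 * a ≤ m
      · rw [hvLowM j a ha hdiag hlow, hn]
      · rw [hvTopM j a ha hdiag (by omega), hn, zero_div]; split_ifs <;> rfl
    · rw [hvOffM j a ha hdiag, hn]; split_ifs <;> rfl
  by_cases hjd : j < d
  · -- below the conductor: only the `a = 0` cell
    rw [Finset.sum_eq_single 0, pow_zero, one_mul, hv0M, hnM, if_neg (show ¬ (d ≤ j ∧ j ≤ d - 1 + m / 2) from fun h => by omega),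
      if_neg (show ¬ (d + m / 2 ≤ j ∧ j < jl ∧ jl + 1 = d + m) from fun h => by omega), add_zero, add_zero]
    · by_cases hc : j % 2 ≠ d % 2
      · rw [if_pos (show (d ≤ j + 1 ∧ 0 + d = j + 1) ∨ (j + 1 < d ∧ (0 : ℕ) = 0 ∧ (j + d) % 2 = 1) from by omega),
          if_pos (show j < d ∧ j % 2 ≠ d % 2 from ⟨hjd, hc⟩)]
      · rw [if_neg (show ¬ ((d ≤ j + 1 ∧ 0 + d = j + 1) ∨ (j + 1 < d ∧ (0 : ℕ) = 0 ∧ (j + d) % 2 = 1)) from by omega),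
          if_neg (show ¬ (j < d ∧ j % 2 ≠ d % 2) from fun h => hc h.2)]
    · intro a _ ha0
      rw [hzero a (by omega) (by rw [hnM, if_neg (by omega)]), mul_zero]
    · intro h; exact absurd (Finset.mem_range.2 (by omega)) h
  · -- from the conductor on: only the cell `a = j + 1 − d`
    rw [not_lt] at hjd
    have hj1 : j ≠ 0 := by omega
    rw [Finset.sum_eq_single (j + 1 - d), if_neg (show ¬ (j < d ∧ j % 2 ≠ d % 2) from fun h => by omega), zero_add]
    · have hn : nM j (j + 1 - d) = (x + 1) * x ^ (j - 1) := by rw [hnM, if_pos (Or.inl ⟨by omega, by omega⟩), if_neg hj1]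
      by_cases hlow : 2 * (j + 1 - d) ≤ m
      · -- a LOW cell (diagonal or not): alive
        have hv : vM j (j + 1 - d) = nM j (j + 1 - d) := by
          by_cases hdiag : j + m = jl + (j + 1 - d)
          · exact hvLowM j _ (by omega) hdiag hlow
          · rw [hvOffM j _ (by omega) hdiag, if_pos ⟨hlow, Or.inr (by omega)⟩]
        rw [hv, hn, if_pos (show d ≤ j ∧ j ≤ d - 1 + m / 2 from ⟨hjd, by omega⟩),
          if_neg (show ¬ (d + m / 2 ≤ j ∧ j < jl ∧ jl + 1 = d + m) from fun h => by omega), add_zero]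
        have e : (j + 1 - d) + (j - 1) = 2 * j - d := by omega
        calc x ^ (j + 1 - d) * ((x + 1) * x ^ (j - 1)) = (x + 1) * x ^ ((j + 1 - d) + (j - 1)) := by rw [pow_add]; ring
          _ = (x + 1) * x ^ (2 * j - d) := by rw [e]
      · -- a TOP cell: alive only on the `−` diagonal `jl + 1 = d + m`, below `jl`
        rw [if_neg (show ¬ (d ≤ j ∧ j ≤ d - 1 + m / 2) from fun h => by omega), zero_add]
        by_cases hdiag : j + m = jl + (j + 1 - d)
        · rw [hvTopM j _ (by omega) hdiag (by omega), hn]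
          by_cases hc : j < jl
          · rw [if_pos (show jl + 1 = d + m ∧ j < jl from ⟨by omega, hc⟩), if_pos (show d + m / 2 ≤ j ∧ j < jl ∧ jl + 1 = d + m from ⟨by omega, hc, by omega⟩),
              ← mul_div_assoc, div_eq_iff (pow_ne_zero _ hx0)]
            have e : (j + 1 - d) + (j - 1) = (j + m - m / 2 - 1) + (2 * (j + 1 - d) - m) / 2 := by omega
            calc x ^ (j + 1 - d) * ((x + 1) * x ^ (j - 1)) = (x + 1) * x ^ ((j + 1 - d) + (j - 1)) := by rw [pow_add]; ring
              _ = (x + 1) * x ^ (j + m - m / 2 - 1) * x ^ ((2 * (j + 1 - d) - m) / 2) := by rw [e, pow_add]; ring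
          · rw [if_neg (show ¬ (jl + 1 = d + m ∧ j < jl) from fun h => hc h.2), mul_zero, if_neg (show ¬ (d + m / 2 ≤ j ∧ j < jl ∧ jl + 1 = d + m) from fun h => hc h.2.1)]
        · rw [hvOffM j _ (by omega) hdiag, if_neg (fun h => hlow h.1), mul_zero,
            if_neg (show ¬ (d + m / 2 ≤ j ∧ j < jl ∧ jl + 1 = d + m) from fun h => hdiag (by omega))]
    · intro a _ ha
      rcases Nat.eq_zero_or_pos a with rfl | hapos
      · rw [hv0M, hnM, if_neg (by omega), mul_zero]
      · rw [hzero a hapos (by rw [hnM, if_neg (by omega)]), mul_zero]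
    · intro h; exact absurd (Finset.mem_range.2 (by omega)) h

end Summit.HodgeConjecture.HodgeConjecture.Cruxes.H413.F0P3cDyRamToricCensusSumUnrBlocks
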